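import Literature.Probability.LatticeModels.NishimoriPathIdentity
import Literature.Probability.LatticeModels.PositiveCurrentModel
import Literature.MathematicalPhysics.QuantumFieldTheory.VillainKernelAnalysis
import HarnessLib

/-!
# Plane rotators with a general even single-bond weight and quenched bond phases
# (the setting of Garban–Spencer 2022, Remark 10: "the Villain interaction may be addressed the same way")

C. Garban, T. Spencer, *Continuous symmetry breaking along the Nishimori line*, J. Math. Phys.
**63** (2022) 093302 = arXiv:2109.01617, prove long-range order for the XY model in `d ≥ 3` by a
Bayesian (Nishimori-line) argument whose only model-specific inputs are (Def. 1–2, Lemma 2.1,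
(2.5)–(2.10), Remark 1): the Gibbs weight is a PRODUCT over bonds of one function of the bond
variable `Y_a = u_a θ̄_{src a} θ_{tgt a}`, the disorder draws the phases `u_a` independently from that
same function (normalised), and two correlation facts about that function (its first trigonometric
moment `λ > 0`, and the Messager–Miracle-Solé–Pfister inequality). Remark 10 of the source records
that the Villain interaction is handled the same way.  The tree's files `DisorderedXYModel`,
`NishimoriGaugeIdentity`, `NishimoriPathIdentity`, `NishimoriPathEstimator`, `MMPInequality` carry out
the argument for the cosine weight `W(z) = e^{β Re z}` only.

This file is the common vocabulary for running the SAME argument with an arbitrary continuous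
positive single-bond weight `W : U(1) → ℝ` (definitions and elementary API only), so that the Villain
weight `W(e^{iφ}) = v_β(φ) = ∑_m exp(−(β/2)(φ + 2πm)²)` (`villainCircleWeight`, built on the tree's
`Literature.MathematicalPhysics.QuantumFieldTheory.villainKernel`) becomes an instance:

* `BondSystem.pairWeight G W u θ = ∏_a W(Y_a(θ, u))` — the Gibbs weight with bond phases `u` (for
  `W = vonMisesWeight β` this is literally `BondSystem.weight G β u`, `pairWeight_vonMisesWeight`);
  `pairPartitionFn`, `pairExpect`, `pairCexpect` — partition function and real / complex Gibbs
  expectations w.r.t. the Haar probability measure `torusHaar V` of `U(1)^V`;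
* `circleWeightZ W = ∫ W`, `circleWeightMean W = ∫ Re z W(z) dz / ∫ W` — the normalisation and the
  mean resultant `λ_W` of the single-bond law `W(z)dz/Z_W` (Garban–Spencer's `λ`, (2.5));
* `pairDensity W u = ∏_a W(u_a)/Z_W`, `pairAvg W Φ = ∫ Φ(u) ∏_a W(u_a)/Z_W du` — the Nishimori
  disorder "`u ≡ β`" for the weight `W` and its averaged quenched expectation (Def. 1–2);
* `BondSystem.pairEstimator` — Garban–Spencer's estimator (2.9) `R(u) = ∑_s w_s λ_W^{-|T_s|} U_{T_s}(u)`
  over a path ensemble (unit chains `T_s`, `BondSystem.UnitChain` of `NishimoriPathIdentity`);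
* `villainCircleWeight β z = v_β(arg z)` — the Villain single-bond weight on `U(1)`;
* `JCurrent.bondSystem d L M` — the oriented bonds `(s, μ) : s → s + e_μ` of the space-time torus
  `(ℤ/Lℤ)^d × ℤ/Mℤ` (`JCurrent.Bond`, `PositiveCurrentModel.lean`) as a `BondSystem`, the graph on
  which the rotator dual to the integer-current models `PositiveCurrentModel` / `VillainCurrentModel`
  lives.

Proved here: positivity / continuity / integrability of the weights, `Z > 0`, `⟨1⟩ = 1`,
`|⟨F⟩| ≤ sup |F|`, gauge covariance `⟨F⟩_{u·Y(φ,1)} = ⟨F(·φ⁻¹)⟩_u`, and the identification with the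
cosine model.  The gauge identity, the path identities, the MMP inequality for the Villain weight and
the long-range-order bound are separate (theorem-only) files.

## References

* C. Garban, T. Spencer, J. Math. Phys. 63 (2022) 093302, arXiv:2109.01617: Def. 1–2, (1.3)–(1.4),
  (2.5), (2.9), Remark 10. [GarbanSpencer2022]
* J. Fröhlich, T. Spencer, Comm. Math. Phys. 83 (1982) 411–454, (2.2) (the Villain weight).
  [FrohlichSpencerCMP1982]
-/

noncomputable section

open MeasureTheory Finset TopologicalSpace
open scoped BigOperators ComplexConjugate

namespace Literature.Probability.LatticeModels

open Literature.MathematicalPhysics.QuantumFieldTheory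

/-! ### The single-bond law on `U(1)`: normalisation and mean resultant -/

section SingleBond

variable [MeasurableSpace Circle] [BorelSpace Circle]

/-- The normalisation `Z_W = ∫ W(z) dz` of a single-bond weight `W` on `U(1)` (Haar probability
`dz`); for `W = e^{β Re z}` this is `vonMisesZ β` (Garban–Spencer 2022, Def. 1, the normalisation of
`ρ_u`). [cite: GarbanSpencer2022, Definition 1] -/
def circleWeightZ (W : Circle → ℝ) : ℝ :=
  ∫ z, W z ∂Measure.haarMeasure (⊤ : PositiveCompacts Circle)

/-- The **mean resultant** `λ_W = ∫ Re z W(z) dz / ∫ W(z) dz` of the single-bond law `W(z)dz/Z_W`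
(Garban–Spencer 2022, (2.5): `λ = 𝔼[cos ω]`; for `W = e^{β Re z}` it is `vonMisesMean β = I₁(β)/I₀(β)`,
for the Villain weight `v_β` it is `e^{-1/(2β)}`). [cite: GarbanSpencer2022, (2.5)] -/
def circleWeightMean (W : Circle → ℝ) : ℝ :=
  (∫ z, (z : ℂ).re * W z ∂Measure.haarMeasure (⊤ : PositiveCompacts Circle)) / circleWeightZ W

/-- `Z_W > 0` for a continuous positive weight. [folklore] -/
theorem circleWeightZ_pos {W : Circle → ℝ} (hW : Continuous W) (hW0 : ∀ z, 0 < W z) :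
    0 < circleWeightZ W := by
  unfold circleWeightZ
  have hint : Integrable W (Measure.haarMeasure (⊤ : PositiveCompacts Circle)) :=
    integrable_of_continuous_of_isFiniteMeasure _ hW
  rw [integral_pos_iff_support_of_nonneg (fun z => (hW0 z).le) hint]
  have hsupp : Function.support W = Set.univ := by
    ext z; simp [(hW0 z).ne']
  rw [hsupp]
  simp [← PositiveCompacts.coe_top, Measure.haarMeasure_self]

/-- `|λ_W| ≤ 1` for a continuous positive weight (`|Re z| ≤ 1` on `U(1)`). [folklore] -/
theorem abs_circleWeightMean_le_one {W : Circle → ℝ} (hW : Continuous W) (hW0 : ∀ z, 0 < W z) :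
    |circleWeightMean W| ≤ 1 := by
  have hZ := circleWeightZ_pos hW hW0
  rw [circleWeightMean, abs_div, abs_of_pos hZ, div_le_one hZ, circleWeightZ]
  refine (abs_integral_le_integral_abs).trans (integral_mono_of_nonneg (ae_of_all _ fun _ => abs_nonneg _)
    (integrable_of_continuous_of_isFiniteMeasure _ hW) (ae_of_all _ fun z => ?_))
  show |(z : ℂ).re * W z| ≤ W z
  rw [abs_mul, abs_of_pos (hW0 z)]
  exact mul_le_of_le_one_left (hW0 z).le ((Complex.abs_re_le_norm _).trans_eq (Circle.norm_coe z))

end SingleBond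

/-! ### The Nishimori disorder for a general weight -/

section Disorder

variable [MeasurableSpace Circle] [BorelSpace Circle] {ι : Type*} [Fintype ι]

/-- The density (w.r.t. the Haar probability of `U(1)^ι`) of the **Nishimori disorder for the weight
`W`**: independent bond phases, each with law `W(u_a) du_a / Z_W` (Garban–Spencer 2022, Def. 1–2 with
`u ≡ β`; for `W = e^{β Re z}` this is `nishimoriDensity β`). [cite: GarbanSpencer2022, Definitions 1 and 2] -/
def pairDensity (W : Circle → ℝ) (u : ι → Circle) : ℝ :=
  ∏ a, W (u a) / circleWeightZ W

/-- The **averaged quenched expectation** `𝔼_W[Φ] = ∫ Φ(u) ∏_a (W(u_a)/Z_W) du` of a disorder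
functional on the Nishimori line of the weight `W` (Garban–Spencer 2022, Def. 2).
[cite: GarbanSpencer2022, Definition 2] -/
def pairAvg {E : Type*} [NormedAddCommGroup E] [NormedSpace ℝ E] (W : Circle → ℝ)
    (Φ : (ι → Circle) → E) : E :=
  ∫ u, pairDensity W u • Φ u ∂torusHaar ι

/-- The disorder density is positive (positive weight). [folklore] -/
theorem pairDensity_pos {W : Circle → ℝ} (hW : Continuous W) (hW0 : ∀ z, 0 < W z) (u : ι → Circle) :
    0 < pairDensity W u :=
  Finset.prod_pos fun a _ => div_pos (hW0 (u a)) (circleWeightZ_pos hW hW0)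

/-- The disorder density is continuous. [folklore] -/
theorem continuous_pairDensity {W : Circle → ℝ} (hW : Continuous W) :
    Continuous (pairDensity (ι := ι) W) :=
  continuous_finsetProd _ fun a _ => (hW.comp (continuous_apply a)).div_const _

/-- The disorder density has total mass one. [folklore] -/
theorem integral_pairDensity {W : Circle → ℝ} (hW : Continuous W) (hW0 : ∀ z, 0 < W z) :
    ∫ u, pairDensity W u ∂torusHaar ι = 1 := by
  unfold pairDensity torusHaar
  rw [integral_fintype_prod_eq_prod (𝕜 := ℝ) (fun (_ : ι) (z : Circle) => W z / circleWeightZ W)]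
  refine Finset.prod_eq_one fun a _ => ?_
  rw [integral_div]
  exact div_self (circleWeightZ_pos hW hW0).ne'

end Disorder

/-! ### The Villain single-bond weight on `U(1)` -/

/-- The **Villain single-bond weight on `U(1)`**: `W(z) = v_β(arg z) = ∑_{m ∈ ℤ} e^{-(β/2)(arg z + 2πm)²}`,
the periodised Gaussian (heat kernel at time `1/β`) of Fröhlich–Spencer 1982 (2.2), as a function of
the bond variable `z = e^{i(θ_{tgt} − θ_{src} + ω)}` (well defined since `v_β` is `2π`-periodic).
[cite: FrohlichSpencerCMP1982, (2.2) (p. 418)] -/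
def villainCircleWeight (β : ℝ) (z : Circle) : ℝ :=
  villainKernel β (Complex.arg (z : ℂ))

/-- The Villain weight is positive (`β > 0`). [folklore] -/
theorem villainCircleWeight_pos {β : ℝ} (hβ : 0 < β) (z : Circle) : 0 < villainCircleWeight β z :=
  villainKernel_pos hβ _

/-- The Villain weight is continuous on `U(1)` (`β > 0`). [folklore] -/
theorem continuous_villainCircleWeight {β : ℝ} (hβ : 0 < β) : Continuous (villainCircleWeight β) :=
  continuous_villainKernel_arg hβ

/-- The Villain weight is even: `W(z⁻¹) = W(z)`. [folklore] -/
theorem villainCircleWeight_inv (β : ℝ) (z : Circle) :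
    villainCircleWeight β z⁻¹ = villainCircleWeight β z :=
  villainKernel_arg_inv β z

/-- The Villain weight at `e^{iφ}` is `v_β(φ)` for every real `φ` (periodicity of `v_β`; `arg e^{iφ}`
differs from `φ` by a multiple of `2π`). [folklore] -/
theorem villainCircleWeight_exp (β φ : ℝ) : villainCircleWeight β (Circle.exp φ) = villainKernel β φ := by
  unfold villainCircleWeight
  rw [Circle.coe_exp, Complex.arg_exp_mul_I, toIocMod, zsmul_eq_mul]
  exact (show Function.Periodic (villainKernel β) (2 * Real.pi) from villainKernel_add_two_pi β).sub_int_mul_eq _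

namespace BondSystem

variable {V ι : Type*} (G : BondSystem V ι)

/-! ### The Gibbs weight `∏_a W(Y_a)` with bond phases -/

section Weight

variable [Fintype ι]

/-- The **Gibbs weight of the plane rotator with single-bond weight `W` and bond phases `u`**:
`∏_a W(Y_a(θ, u))`, `Y_a = u_a θ̄_{src a} θ_{tgt a}` (Garban–Spencer 2022, (1.3) for `W = e^{β Re ·}`;
Remark 10 for the Villain weight). [cite: GarbanSpencer2022, (1.3) and Remark 10] -/
def pairWeight (W : Circle → ℝ) (u : ι → Circle) (θ : V → Circle) : ℝ :=
  ∏ a, W (G.bondVar u θ a)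

/-- For the von Mises weight `W = e^{β Re z}` the general weight is the XY weight of
`DisorderedXYModel`: `∏_a e^{β Re Y_a} = exp (β ∑_a Re Y_a)`. [folklore] -/
theorem pairWeight_vonMisesWeight (β : ℝ) (u : ι → Circle) (θ : V → Circle) :
    G.pairWeight (vonMisesWeight β) u θ = G.weight β u θ := by
  simp only [pairWeight, vonMisesWeight, weight, energy, Finset.mul_sum, Real.exp_sum]

variable {W : Circle → ℝ}

/-- The weight is positive for a positive single-bond weight. [folklore] -/
theorem pairWeight_pos (hW0 : ∀ z, 0 < W z) (u : ι → Circle) (θ : V → Circle) :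
    0 < G.pairWeight W u θ :=
  Finset.prod_pos fun _ _ => hW0 _

/-- The weight is jointly continuous in `(u, θ)` for a continuous single-bond weight. [folklore] -/
theorem continuous_pairWeight_uncurry (hW : Continuous W) :
    Continuous fun p : (ι → Circle) × (V → Circle) => G.pairWeight W p.1 p.2 :=
  continuous_finsetProd _ fun a _ => hW.comp (G.continuous_bondVar_uncurry a)

/-- The weight is continuous in the spins. [folklore] -/
theorem continuous_pairWeight (hW : Continuous W) (u : ι → Circle) : Continuous (G.pairWeight W u) :=
  continuous_finsetProd _ fun a _ => hW.comp (G.continuous_bondVar u a)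

/-- Gauge covariance of the weight: `w(u · Y(φ,1), θ) = w(u, θφ)`.
[cite: GarbanSpencer2022, proof of Lemma 2.1, (2.2)] -/
theorem pairWeight_mul_bondVar_one (W : Circle → ℝ) (u : ι → Circle) (φ θ : V → Circle) :
    G.pairWeight W (u * G.bondVar 1 φ) θ = G.pairWeight W u (θ * φ) := by
  simp only [pairWeight, bondVar_mul_bondVar_one]

end Weight

/-! ### Partition function and Gibbs expectations -/

section Expect

variable [Fintype ι] [Fintype V] [MeasurableSpace Circle] [BorelSpace Circle]

/-- The partition function `Z_{W,u} = ∫ ∏_a W(Y_a(θ,u)) dθ` (Garban–Spencer 2022, (1.4)).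
[cite: GarbanSpencer2022, (1.4)] -/
def pairPartitionFn (W : Circle → ℝ) (u : ι → Circle) : ℝ :=
  ∫ θ, G.pairWeight W u θ ∂torusHaar V

/-- The (real) Gibbs expectation `⟨f⟩_{W,u} = Z⁻¹ ∫ f(θ) ∏_a W(Y_a) dθ`
(Garban–Spencer 2022, (1.4)). [cite: GarbanSpencer2022, (1.4)] -/
def pairExpect (W : Circle → ℝ) (u : ι → Circle) (f : (V → Circle) → ℝ) : ℝ :=
  (∫ θ, f θ * G.pairWeight W u θ ∂torusHaar V) / G.pairPartitionFn W u

/-- The complex Gibbs expectation `⟨F⟩_{W,u}` of a complex observable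
(Garban–Spencer 2022, (1.4), (2.8)). [cite: GarbanSpencer2022, (1.4) and (2.8)] -/
def pairCexpect (W : Circle → ℝ) (u : ι → Circle) (F : (V → Circle) → ℂ) : ℂ :=
  (∫ θ, F θ * G.pairWeight W u θ ∂torusHaar V) / G.pairPartitionFn W u

variable {W : Circle → ℝ}

/-- The weight is integrable (continuous weight). [folklore] -/
theorem integrable_pairWeight (hW : Continuous W) (u : ι → Circle) :
    Integrable (G.pairWeight W u) (torusHaar V) :=
  integrable_torusHaar_of_continuous (G.continuous_pairWeight hW u)

/-- The partition function is positive (continuous positive weight). [folklore] -/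
theorem pairPartitionFn_pos (hW : Continuous W) (hW0 : ∀ z, 0 < W z) (u : ι → Circle) :
    0 < G.pairPartitionFn W u := by
  unfold pairPartitionFn
  rw [integral_pos_iff_support_of_nonneg (fun θ => (G.pairWeight_pos hW0 u θ).le)
    (G.integrable_pairWeight hW u)]
  have hsupp : Function.support (G.pairWeight W u) = Set.univ := by
    ext θ; simp [(G.pairWeight_pos hW0 u θ).ne']
  rw [hsupp, measure_univ]
  exact one_pos

/-- Gauge invariance of the partition function: `Z_{u · Y(φ,1)} = Z_u` (`θ ↦ θφ`).
[cite: GarbanSpencer2022, proof of Lemma 2.1, (2.2)–(2.3)] -/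
theorem pairPartitionFn_mul_bondVar_one (W : Circle → ℝ) (u : ι → Circle) (φ : V → Circle) :
    G.pairPartitionFn W (u * G.bondVar 1 φ) = G.pairPartitionFn W u := by
  simp only [pairPartitionFn, pairWeight_mul_bondVar_one]
  exact integral_torusHaar_mul_right (G.pairWeight W u) φ

/-- `⟨1⟩ = 1`. [folklore] -/
@[simp] theorem pairExpect_one (hW : Continuous W) (hW0 : ∀ z, 0 < W z) (u : ι → Circle) :
    G.pairExpect W u (fun _ => 1) = 1 := by
  simp only [pairExpect, one_mul]
  exact div_self (G.pairPartitionFn_pos hW hW0 u).ne'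

/-- `⟨1⟩ = 1` (complex observable). [folklore] -/
@[simp] theorem pairCexpect_one (hW : Continuous W) (hW0 : ∀ z, 0 < W z) (u : ι → Circle) :
    G.pairCexpect W u (fun _ => 1) = 1 := by
  have h := (G.pairPartitionFn_pos hW hW0 u).ne'
  simp only [pairCexpect, one_mul, pairPartitionFn] at h ⊢
  rw [integral_complex_ofReal, div_self]
  exact_mod_cast h

/-- A real observable's complex expectation is its real expectation. [folklore] -/
theorem pairCexpect_ofReal (W : Circle → ℝ) (u : ι → Circle) (f : (V → Circle) → ℝ) :
    G.pairCexpect W u (fun θ => (f θ : ℂ)) = (G.pairExpect W u f : ℂ) := by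
  simp only [pairCexpect, pairExpect, ← Complex.ofReal_mul, Complex.ofReal_div]
  rw [integral_complex_ofReal]

/-- The real part of a complex expectation is the expectation of the real part (continuous
observable and weight). [folklore] -/
theorem re_pairCexpect (hW : Continuous W) (u : ι → Circle) {F : (V → Circle) → ℂ} (hF : Continuous F) :
    (G.pairCexpect W u F).re = G.pairExpect W u (fun θ => (F θ).re) := by
  have hi : Integrable (fun θ => F θ * G.pairWeight W u θ) (torusHaar V) :=
    integrable_torusHaar_of_continuous (hF.mul (Complex.continuous_ofReal.comp (G.continuous_pairWeight hW u)))
  have h2 := integral_re hi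
  simp only [RCLike.re_to_complex] at h2
  rw [pairCexpect, pairExpect, Complex.div_ofReal_re, ← h2]
  congr 1
  refine integral_congr_ae (ae_of_all _ fun θ => ?_)
  simp [Complex.mul_re]

/-- **`|⟨F⟩| ≤ sup |F|`** for a bounded observable (positive continuous weight). [folklore] -/
theorem norm_pairCexpect_le (hW : Continuous W) (hW0 : ∀ z, 0 < W z) (u : ι → Circle)
    (F : (V → Circle) → ℂ) {C : ℝ} (hC : ∀ θ, ‖F θ‖ ≤ C) : ‖G.pairCexpect W u F‖ ≤ C := by
  have hZ := G.pairPartitionFn_pos hW hW0 u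
  have hC0 : 0 ≤ C := (norm_nonneg _).trans (hC 1)
  rw [pairCexpect, norm_div, Complex.norm_real, Real.norm_of_nonneg hZ.le, div_le_iff₀ hZ]
  calc ‖∫ θ, F θ * G.pairWeight W u θ ∂torusHaar V‖
      ≤ ∫ θ, ‖F θ * (G.pairWeight W u θ : ℂ)‖ ∂torusHaar V := norm_integral_le_integral_norm _
    _ ≤ ∫ θ, C * G.pairWeight W u θ ∂torusHaar V := by
        refine integral_mono_of_nonneg (ae_of_all _ fun _ => norm_nonneg _)
          ((G.integrable_pairWeight hW u).const_mul C) (ae_of_all _ fun θ => ?_)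
        show ‖F θ * (G.pairWeight W u θ : ℂ)‖ ≤ C * G.pairWeight W u θ
        rw [norm_mul, Complex.norm_real, Real.norm_of_nonneg (G.pairWeight_pos hW0 u θ).le]
        exact mul_le_mul_of_nonneg_right (hC θ) (G.pairWeight_pos hW0 u θ).le
    _ = C * G.pairPartitionFn W u := by rw [integral_const_mul]; rfl

/-- `|⟨f⟩| ≤ sup |f|` for a real observable. [folklore] -/
theorem abs_pairExpect_le (hW : Continuous W) (hW0 : ∀ z, 0 < W z) (u : ι → Circle)
    (f : (V → Circle) → ℝ) {C : ℝ} (hC : ∀ θ, |f θ| ≤ C) : |G.pairExpect W u f| ≤ C := by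
  have h := G.norm_pairCexpect_le hW hW0 u (fun θ => (f θ : ℂ))
    (fun θ => by rw [Complex.norm_real, Real.norm_eq_abs]; exact hC θ)
  rwa [pairCexpect_ofReal, Complex.norm_real, Real.norm_eq_abs] at h

/-- Gauge covariance of expectations: `⟨F⟩_{u · Y(φ,1)} = ⟨F(· φ⁻¹)⟩_u`.
[cite: GarbanSpencer2022, proof of Lemma 2.1, (2.2)–(2.3)] -/
theorem pairCexpect_mul_bondVar_one (W : Circle → ℝ) (u : ι → Circle) (φ : V → Circle)
    (F : (V → Circle) → ℂ) :
    G.pairCexpect W (u * G.bondVar 1 φ) F = G.pairCexpect W u (fun θ => F (θ * φ⁻¹)) := by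
  rw [pairCexpect, pairCexpect, pairPartitionFn_mul_bondVar_one]
  congr 1
  simp only [pairWeight_mul_bondVar_one]
  have h := integral_torusHaar_mul_right (fun θ => F (θ * φ⁻¹) * (G.pairWeight W u θ : ℂ)) φ
  simpa only [mul_inv_cancel_right] using h

/-- A `u`-dependent constant factor leaves the expectation: `⟨F · c⟩_u = ⟨F⟩_u · c`. [folklore] -/
theorem pairCexpect_mul_const (W : Circle → ℝ) (u : ι → Circle) (F : (V → Circle) → ℂ) (c : ℂ) :
    G.pairCexpect W u (fun θ => F θ * c) = G.pairCexpect W u F * c := by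
  simp only [pairCexpect]
  rw [div_mul_eq_mul_div, ← integral_mul_const]
  congr 1
  refine integral_congr_ae (ae_of_all _ fun θ => ?_)
  ring

/-- The spin–spin correlation is at most `1` in absolute value. [folklore] -/
theorem abs_pairExpect_cosDiff_le_one (hW : Continuous W) (hW0 : ∀ z, 0 < W z) (u : ι → Circle)
    (x y : V) : |G.pairExpect W u (cosDiff x y)| ≤ 1 :=
  G.abs_pairExpect_le hW hW0 u (cosDiff x y) (abs_cosDiff_le_one x y)

/-- For the von Mises weight the general expectation is the XY expectation of `DisorderedXYModel`.
[folklore] -/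
theorem pairExpect_vonMisesWeight (β : ℝ) (u : ι → Circle) (f : (V → Circle) → ℝ) :
    G.pairExpect (vonMisesWeight β) u f = G.expect β u f := by
  simp only [pairExpect, pairPartitionFn, expect, partitionFn, pairWeight_vonMisesWeight]

end Expect

/-! ### Garban–Spencer's estimator for a general weight -/

section Estimator

variable [Fintype ι] [MeasurableSpace Circle] [BorelSpace Circle] {x y : V} {S : Type*} [Fintype S]

/-- **Garban–Spencer's estimator (2.9) for the weight `W`**: `R(u) = ∑_s w_s λ_W^{-|T_s|₁} U_{T_s}(u)`,
the `ν`-average over a path ensemble (weights `w_s`, unit chains `T_s` from `x` to `y`) of the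
length-renormalised disorder holonomies, with Garban–Spencer's `λ` replaced by the mean resultant
`λ_W` of the single-bond law. [cite: GarbanSpencer2022, (2.9) and Remark 10] -/
def pairEstimator (W : Circle → ℝ) (w : S → ℝ) (T : S → G.UnitChain x y) (u : ι → Circle) : ℂ :=
  ∑ s, (w s * (circleWeightMean W)⁻¹ ^ (T s).length : ℝ) * (T s).holonomy u

/-- The estimator is continuous in the disorder. [folklore] -/
theorem continuous_pairEstimator (W : Circle → ℝ) (w : S → ℝ) (T : S → G.UnitChain x y) :
    Continuous (G.pairEstimator W w T) :=
  continuous_finsetSum _ fun s _ => continuous_const.mul (T s).continuous_holonomy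

end Estimator

end BondSystem

/-! ### The bond system of the space-time torus -/

namespace JCurrent

/-- **The bond system of the space-time torus** `(ℤ/Lℤ)^d × ℤ/Mℤ`: the positively oriented bonds
`(s, μ)` of `JCurrent.Bond d L M`, from `s` to `s + e_μ` (Wallin et al. 1994 §II; for `M = 1` the
temporal bonds are loops `s → s`). The rotator model `∏_{(s,μ)} W(θ̄_s θ_{s+e_μ}) dθ` on this bond
system is the Fourier dual of the integer-current models of `PositiveCurrentModel.lean`.
[cite: WallinEtAl1994, §II] -/
def bondSystem (d L M : ℕ) : BondSystem (SpaceTimeSite d L M) (Bond d L M) where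
  src b := b.1
  tgt b := b.1 + unitVec b.2

end JCurrent

end Literature.Probability.LatticeModels
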